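import Literature.NumberTheory.EllipticCurves.AnticyclotomicSignedSelmer
import Literature.NumberTheory.EllipticCurves.Kobayashi2003.FineSelmerLeSignedSelmerProofs
import Summits.BirchSwinnertonDyer.Rank1Residual.X2.GreenbergVatsalSelmerLink
import Summits.BirchSwinnertonDyer.Rank1Residual.X11b.PrimaryInclusionLevels
import Summits.BirchSwinnertonDyer.Rank1Residual.Additive.StrictSignedSelmerInftyLocal
import Summits.BirchSwinnertonDyer.BirchSwinnertonDyer.Theorems.AlignedTransportAtTwoMainConjectureOfRankZeroBSDAtTwoFineRoadLocalArch
import HarnessLib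

/-!
# Stub (a) `stub_xAcTorsionSS` of line `bdpline` (crux `AnticyclotomicEisensteinDivisibility`,
# stmt-BirchSwinnertonDyer-20727) — helper 2a: the two transcriptions of the signed Selmer group over a
# `ℤ_p`-extension COINCIDE — the inclusion `⊇` and the LOCAL descent step above `p`

Width seat bsd-line-sbc-p1-w4 (gen 0), `--supports stmt-BirchSwinnertonDyer-20727`. The tree carries the
signed (plus/minus) Selmer group of an elliptic curve over a `ℤ_p`-extension `K_∞/K` in two models:
* `Kobayashi2003.signedSelmerInfty W κ ε = ⨆ₙ res (Sel^ε(E/K_n))` — the DIRECT LIMIT of the layer groups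
  (Kobayashi Def. 1.1; Iovita–Pollack Def. 6.7; the carrier of the REFEREED rank-one theorem
  `AcSigned.longoVigni2019_thm14_signedSelmerDual_rank_one`);
* `AcSigned.selmer W p κ ∅ (fun _ ↦ .sgn ε)` — cut out DIRECTLY over `K_∞` by B.-D. Kim's `K_∞`-level
  condition `ℋ^ε_w = ⋃ₙ E^ε(K_{n,w}) ⊗ ℚ_p/ℤ_p` above `p` and the strict condition away from `p`
  (Castella–Wan Def. 5.1 `Sel^{±,±}(K, 𝐀^ac)`; the carrier of the tree's transfer theorem
  `AcSigned.TransferInputs.isFGTorsion_and_sq_mem_charIdeal` and of helper 1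
  `…XAcTorsionTransfer`), the reading flag `away-p` of `AnticyclotomicSignedSelmer.lean` recording that
  their identity was NOT proved.
This file PROVES the identity (for `p` odd and under "`E(K_{∞,w})[p^∞] = 0` at every `w ∣ p`", the
standing fact of the supersingular setting — B.-D. Kim 2013 Prop. 3.2 / Iovita–Pollack Lemma 2.1, PROVED
in the tree for `AcSigned.Setting`: `fixedPoints_decomp_inf_kerSubgroup_geomPrimaryTorsion_eq_bot_of_setting`):
* §1 `signedSelmerInfty_le_selmer_sgn` (`⊇`, odd `p`, any number field, any `ℤ_p`-extension): a layer
  class is classical over `K_∞`, hence locally trivial at `v ∤ p` (Greenberg LNM 1716 Prop. 2.1, tree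
  `LocalAway.conjH1_mem_awayKer_of_mem_selmerInfty`), nothing at `∞` for odd `p`
  (`LocalArch.infKer_kerSubgroup_eq_top_of_odd`), and satisfies `ℋ^ε` above `p`
  (`AcSigned.signedSelmerInfty_le_condAbove_sgn`);
* §2 `selmer_sgn_le_selmerInfty` (a class of Kim's group is classical over `K_∞`) and the LOCAL STEP
  `resOfLe_mem_localKummerOverOfEmb_of_kummer_data`: ABOVE `p` the Kummer datum of a class `c = res y`
  (`φ₀ = ∂Q` on `Gal(K̄_v/K_{∞,w})`, `pᵏQ ∈ E^ε(K_{n₀,w})`) and the classical datum of `y`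
  (`φ = ∂P` on `Gal(K̄_v/K_{n,w})`) differ by a point `R = P − Q − t` FIXED by `Gal(K̄_v/K_{∞,w})`; for
  `τ ∈ Gal(K̄_v/K_{m,w})`, `τR − R` is a `p`-power torsion point fixed by `Gal(K̄_v/K_{∞,w})`, hence `0`
  by the no-`p`-torsion hypothesis — so `φ = ∂(Q + t)` on the whole layer group: Kobayashi's Kummer
  condition at the layer `m ≥ n, n₀` with the point `Q + t`.
The global assembly (`⊆`, `=`) is the sibling file `…XAcTorsionSignedCarrier.lean`.
Kernel plumbing between two existing tree objects; no definition, no named fact; nothing about BSD.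

References: [Kobayashi2003] Def. 1.1; [BDKim2013] Def. 3.1/3.3, Prop. 3.2; [IovitaPollack2006] Def. 6.7,
Lemma 2.1; [CastellaWan2023] Def. 5.1 (MS p. 23); [GreenbergLNM1716] §2 Prop. 2.1, §3 Lemmas 3.2–3.3.
-/

-- D-0017: single-problem summit, the namespace repeats the problem name by design.
set_option linter.dupNamespace false
set_option autoImplicit false

noncomputable section

open scoped Classical

universe u

namespace Summit.BirchSwinnertonDyer.BirchSwinnertonDyer.Theorems.SignedBaseChangeAcDivXAcTorsionCarrier

open NumberField IsDedekindDomain Field Filter Topology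
open Literature.NumberTheory.EllipticCurves Literature.NumberTheory.EllipticCurves.GreenbergSelmer
  Literature.NumberTheory.GaloisRepresentations WeierstrassCurve ZpExtension
  Literature.NumberTheory.EllipticCurves.Kobayashi2003 Literature.NumberTheory.EllipticCurves.AcSigned
  Summit.BirchSwinnertonDyer.BirchSwinnertonDyer.Theorems.AlignedTransportAtTwoFineRoad

variable {K : Type u} [Field K] [NumberField K] (W : WeierstrassCurve K) {p : ℕ} [Fact p.Prime]
  (κ : ZpExtension K p)

/-! ## §1 `lim→ Sel^ε(E/K_n) ≤ Sel^{±}(K_∞)` (odd `p`) -/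

/-- **`⊇`: Kobayashi's direct limit lies in Kim's `K_∞`-level group** (odd `p`, any number field, any
`ℤ_p`-extension, any elliptic `W`): a class restricted from `Sel^ε(E/K_n)` is classical over `K_∞`
(`signedSelmerInfty_le_selmerInfty`), hence locally trivial at every place of `K_∞` prime to `p`
(Greenberg, LNM 1716 Prop. 2.1: `Im κ_η = 0` for `η ∤ p`), the archimedean condition is vacuous for odd
`p`, and above `p` it satisfies `ℋ^ε` (`signedSelmerInfty_le_condAbove_sgn`).
[cite: GreenbergLNM1716, §2 Prop. 2.1 and (2) (p. 72)] [cite: BDKim2013, Def. 3.1, Def. 3.3 (p. 193)] -/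
theorem signedSelmerInfty_le_selmer_sgn [W.IsElliptic] (hp : p ≠ 2) (ε : ℤˣ) :
    signedSelmerInfty W κ ε ≤ AcSigned.selmer W p κ ∅ (fun _ ↦ .sgn ε) := by
  intro s hs
  have hs' : s ∈ W.selmerInfty κ := signedSelmerInfty_le_selmerInfty W κ ε hs
  rw [mem_selmer_iff]
  refine ⟨?_, fun v hv ↦ signedSelmerInfty_le_condAbove_sgn hv ε hs⟩
  rw [mem_awayConditions_iff]
  refine ⟨fun v hv _ σ ↦ ?_, fun w σ ↦ ?_⟩
  · exact LocalAway.conjH1_mem_awayKer_of_mem_selmerInfty W κ hs' v hv σ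
  · rw [LocalArch.infKer_kerSubgroup_eq_top_of_odd W κ hp w]
    exact AddSubgroup.mem_top _

/-! ## §2 `Sel^{±}(K_∞) ≤ lim→ Sel^ε(E/K_n)` under `E(K_{∞,w})[p^∞] = 0` at `w ∣ p` -/

/-- A class of Kim's `Sel^{±}(K_∞)` satisfies the CLASSICAL conditions over `K_∞` (`W.selmerInfty κ`):
at `v ∤ p` locally trivial ⟹ classical (`Kobayashi2003.mem_localKerOver_of_resOfLe_inf_eq_zero`), at
`∞` likewise, above `p` the Kummer condition refines the classical one
(`signedKummerInfty_le_localKerOverOfEmb`). [cite: BDKim2013, Def. 3.1 (p. 193)] [cite: GreenbergLNM1716, §2] -/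
theorem selmer_sgn_le_selmerInfty (ε : ℤˣ) :
    AcSigned.selmer W p κ ∅ (fun _ ↦ .sgn ε) ≤ W.selmerInfty κ := by
  intro c hc
  have hsel := (mem_selmer_iff c).1 hc
  have haway := (mem_awayConditions_iff W p κ c).1 hsel.1
  rw [WeierstrassCurve.selmerInfty, WeierstrassCurve.mem_selmerGroupOver_iff]
  refine ⟨fun v σ ↦ ?_, fun w σ ↦ ?_⟩
  · by_cases hv : ((p : ℕ) : 𝓞 K) ∈ v.asIdeal
    · have h := (mem_condAbove_sgn_iff W p κ v ε c).1 (hsel.2 v hv) σ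
      rw [WeierstrassCurve.localKerOver_eq_ofEmb]
      exact signedKummerInfty_le_localKerOverOfEmb W p κ _ ε h
    · exact mem_localKerOver_of_resOfLe_inf_eq_zero W p (resGalOfEmb_mem_decomp v)
        (haway.1 v hv (fun h ↦ h) σ)
  · exact mem_localKerOver_of_resOfLe_inf_eq_zero W p (resGalOfEmb_mem_decompInf w) (haway.2 w σ)


set_option maxHeartbeats 4000000 in
/-- **The local step above `p`.** Fix `v ∣ p` with completion `E = K_v` and the chosen embedding
`ι : K̄ → K̄_v`, a cocycle `φ` on `Γ_n = Gal(K̄/K_n)` which is CLASSICALLY Kummer at the place of `K_n`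
(`ι φ = ∂P` on `Gal(K̄_v/K_n·K_v)`, `P ∈ E(K̄_v)`), a cocycle `φ₀` on `Gal(K̄/K_∞)` which is SIGNED-Kummer
over `K_∞` (`ι φ₀ = ∂Q` on `Gal(K̄_v/K_∞·K_v)`, `pᵏ Q ∈ E^ε(K_{n₀}·K_v)`), and suppose `φ|_{Γ_∞}` and `φ₀`
are cohomologous (`φ − φ₀ = ∂t`, `t ∈ E[p^∞]`). If `E[p^∞]` has no non-zero point fixed by
`D_v ⊓ Gal(K̄/K_∞)` (`E(K_{∞,w})[p^∞] = 0`), then at every layer `m ≥ n, n₀` the restriction of `[φ]` to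
`Γ_m` satisfies KOBAYASHI's signed Kummer condition `E^ε(K_m·K_v) ⊗ ℚ_p/ℤ_p` with the point `Q + ι t`:
the point `R = P − Q − ι t` is fixed by `Gal(K̄_v/K_∞·K_v)`, and for `τ ∈ Gal(K̄_v/K_m·K_v)` the
difference `τR − R` is a `p`-power torsion point fixed by `Gal(K̄_v/K_∞·K_v)`, hence zero.
[cite: BDKim2013, Def. 3.1, Def. 3.3 and Prop. 3.2 (pp. 192–193)] [cite: Kobayashi2003, Def. 1.1] -/
theorem resOfLe_mem_localKummerOverOfEmb_of_kummer_data [W.IsElliptic] {n n₀ m : ℕ} (hnm : n ≤ m)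
    (hn₀m : n₀ ≤ m) {E : Type u} [Field E] [Algebra K E]
    (hNT : ∀ s : W.geomPrimaryTorsion p,
      (∀ σ : absoluteGaloisGroup E, σ ∈ localSubgroupOfEmb κ.kerSubgroup (closureEmb (K := K) E) →
        resGalOfEmb (closureEmb (K := K) E) σ • s = s) → s = 0)
    (φ : contOneCocycles (discreteTopRep (κ.layerSubgroup n) (W.geomPrimaryTorsion p)))
    (P : localPoints W E)
    (hP : ∀ τ : localSubgroup (κ.layerSubgroup n) E,
      pointsMap W E ((φ.1 (resGalSubgroup (κ.layerSubgroup n) E τ) : W.geomPrimaryTorsion p) :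
        W.geomPoints) = (τ : absoluteGaloisGroup E) • P - P)
    (φ₀ : contOneCocycles (discreteTopRep κ.kerSubgroup (W.geomPrimaryTorsion p)))
    (Q : localPoints W E) (k : ℕ) (ε : ℤˣ)
    (hQA : p ^ k • Q ∈ signedLocalPointsOfEmb κ (closureEmb (K := K) E) W ε n₀)
    (hQ : ∀ τ : localSubgroupOfEmb κ.kerSubgroup (closureEmb (K := K) E),
      pointsMapOfEmb W (closureEmb (K := K) E)
          ((φ₀.1 (resGalSubgroupOfEmb κ.kerSubgroup (closureEmb (K := K) E) τ) :
              W.geomPrimaryTorsion p) : W.geomPoints) =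
        (τ : absoluteGaloisGroup E) • Q - Q)
    (t : W.geomPrimaryTorsion p)
    (ht : ∀ (g : absoluteGaloisGroup K) (hg : g ∈ κ.layerSubgroup n) (hg' : g ∈ κ.kerSubgroup),
      φ.1 ⟨g, hg⟩ - φ₀.1 ⟨g, hg'⟩ = g • t - t) :
    Literature.NumberTheory.EllipticCurves.resOfLe (W.geomPrimaryTorsion p) (κ.layerSubgroup_antitone hnm)
        (oneCocycleClass _ φ) ∈
      localKummerOverOfEmb W p (κ.layerSubgroup m) (closureEmb (K := K) E)
        (signedLocalPoints κ E W ε m) := by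
  set ι : AlgebraicClosure K →ₐ[K] AlgebraicClosure E := closureEmb (K := K) E with hι
  have hp : p.Prime := Fact.out
  obtain ⟨j, hj⟩ := t.2
  -- local subgroups along the tower
  have hker_le_n : localSubgroupOfEmb κ.kerSubgroup ι ≤ localSubgroupOfEmb (κ.layerSubgroup n) ι :=
    Subgroup.comap_mono (κ.kerSubgroup_le_layerSubgroup n)
  have hm_le_n : localSubgroupOfEmb (κ.layerSubgroup m) ι ≤ localSubgroupOfEmb (κ.layerSubgroup n) ι :=
    Subgroup.comap_mono (κ.layerSubgroup_antitone hnm)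
  have hm_le_n₀ : localSubgroupOfEmb (κ.layerSubgroup m) ι ≤ localSubgroupOfEmb (κ.layerSubgroup n₀) ι :=
    Subgroup.comap_mono (κ.layerSubgroup_antitone hn₀m)
  -- `ι(φ − φ₀) = ∂(ι t)` on `Gal(K̄_v/K_∞·K_v)`, pointwise
  have hdiff : ∀ (τ : absoluteGaloisGroup E) (hτ : τ ∈ localSubgroupOfEmb κ.kerSubgroup ι),
      pointsMapOfEmb W ι ((φ.1 ⟨resGalOfEmb ι τ, hker_le_n hτ⟩ : W.geomPrimaryTorsion p) : W.geomPoints) -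
        pointsMapOfEmb W ι ((φ₀.1 ⟨resGalOfEmb ι τ, hτ⟩ : W.geomPrimaryTorsion p) : W.geomPoints) =
      τ • pointsMapOfEmb W ι (t : W.geomPoints) - pointsMapOfEmb W ι (t : W.geomPoints) := by
    intro τ hτ
    have h3 := congrArg (fun s : W.geomPrimaryTorsion p ↦ pointsMapOfEmb W ι (s : W.geomPoints))
      (ht (resGalOfEmb ι τ) (hker_le_n hτ) hτ)
    simp only [AddSubgroupClass.coe_sub, map_sub, primaryComponent.coe_smul, pointsMapOfEmb_smul] at h3
    exact h3
  -- the point `R = P − Q − ι t` is fixed by `Gal(K̄_v/K_∞·K_v)`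
  set R : localPoints W E := P - Q - pointsMapOfEmb W ι (t : W.geomPoints) with hR
  have hRfix : ∀ (τ : absoluteGaloisGroup E), τ ∈ localSubgroupOfEmb κ.kerSubgroup ι → τ • R = R := by
    intro τ hτ
    have h1 := hP ⟨τ, hker_le_n hτ⟩
    have h2 := hQ ⟨τ, hτ⟩
    have h3 := hdiff τ hτ
    change pointsMapOfEmb W ι ((φ.1 ⟨resGalOfEmb ι τ, hker_le_n hτ⟩ : W.geomPrimaryTorsion p) :
      W.geomPoints) = τ • P - P at h1
    change pointsMapOfEmb W ι ((φ₀.1 ⟨resGalOfEmb ι τ, hτ⟩ : W.geomPrimaryTorsion p) : W.geomPoints) =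
      τ • Q - Q at h2
    rw [h1, h2] at h3
    rw [hR, smul_sub, smul_sub]
    -- `τP − P − (τQ − Q) = τ ιt − ιt`
    have e : τ • P - τ • Q - τ • pointsMapOfEmb W ι (t : W.geomPoints) -
        (P - Q - pointsMapOfEmb W ι (t : W.geomPoints)) =
        (τ • P - P - (τ • Q - Q)) - (τ • pointsMapOfEmb W ι (t : W.geomPoints) -
          pointsMapOfEmb W ι (t : W.geomPoints)) := by abel
    rw [← sub_eq_zero, e, h3, sub_self]
  -- for `τ ∈ Gal(K̄_v/K_m·K_v)`: `τR − R` is `p`-power torsion …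
  have hDtors : ∀ (τ : absoluteGaloisGroup E), τ ∈ localSubgroupOfEmb (κ.layerSubgroup m) ι →
      ∃ N : ℕ, p ^ N • (τ • R - R) = 0 := by
    intro τ hτ
    -- `τP − P = ι φ(τ)` is the image of a point of `E[p^∞]`
    obtain ⟨a, ha⟩ := (φ.1 ⟨resGalOfEmb ι τ, hm_le_n hτ⟩).2
    have h1 := hP ⟨τ, hm_le_n hτ⟩
    change pointsMapOfEmb W ι ((φ.1 ⟨resGalOfEmb ι τ, hm_le_n hτ⟩ : W.geomPrimaryTorsion p) :
      W.geomPoints) = τ • P - P at h1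
    have hPa : p ^ a • (τ • P - P) = 0 := by rw [← h1, ← map_nsmul, ha, map_zero]
    -- `pᵏ(τQ − Q) = 0`: `pᵏ Q ∈ E^ε(K_{n₀}) ⊆ E(K_{n₀}·K_v)` is fixed by `τ`
    have hQk : p ^ k • (τ • Q - Q) = 0 := by
      have hfix : τ • (p ^ k • Q) = p ^ k • Q :=
        (mem_localLayerPointsOfEmb_iff κ ι W n₀ _).1 (signedLocalPointsOfEmb_le κ ι W ε n₀ hQA) τ
          (hm_le_n₀ hτ)
      rw [smul_sub, smul_comm, hfix, sub_self]
    -- `pʲ(τ ιt − ιt) = 0`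
    have htj : p ^ j • (τ • pointsMapOfEmb W ι (t : W.geomPoints) -
        pointsMapOfEmb W ι (t : W.geomPoints)) = 0 := by
      rw [smul_sub, smul_comm, ← map_nsmul, hj, map_zero, smul_zero, sub_self]
    refine ⟨a + k + j, ?_⟩
    have e : τ • R - R = (τ • P - P) - (τ • Q - Q) -
        (τ • pointsMapOfEmb W ι (t : W.geomPoints) - pointsMapOfEmb W ι (t : W.geomPoints)) := by
      rw [hR, smul_sub, smul_sub]; abel
    have kill : ∀ {x : localPoints W E} {c d : ℕ}, p ^ c • x = 0 → c ≤ d → p ^ d • x = 0 := by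
      intro x c d hx hcd
      obtain ⟨e, rfl⟩ := Nat.exists_eq_add_of_le hcd
      rw [pow_add, mul_comm, mul_smul, hx, smul_zero]
    rw [e, nsmul_sub, nsmul_sub, kill hPa (by omega), kill hQk (by omega), kill htj (by omega),
      sub_zero, sub_zero]
  -- … and fixed by `Gal(K̄_v/K_∞·K_v)` (normality), hence ZERO by the no-`p`-torsion hypothesis
  have hDfix : ∀ (τ : absoluteGaloisGroup E), τ ∈ localSubgroupOfEmb (κ.layerSubgroup m) ι →
      ∀ (σ : absoluteGaloisGroup E), σ ∈ localSubgroupOfEmb κ.kerSubgroup ι →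
        σ • (τ • R - R) = τ • R - R := by
    intro τ _ σ hσ
    have hconj : τ⁻¹ * σ * τ ∈ localSubgroupOfEmb κ.kerSubgroup ι := by
      rw [mem_localSubgroupOfEmb_iff, mem_kerSubgroup] at hσ ⊢
      simp only [map_mul, map_inv]
      rw [hσ, mul_one, inv_mul_cancel]
    have h1 : σ • τ • R = τ • R :=
      calc σ • τ • R = (σ * τ) • R := (mul_smul σ τ R).symm
        _ = (τ * (τ⁻¹ * σ * τ)) • R := by
            rw [← mul_assoc, ← mul_assoc, mul_inv_cancel, one_mul]
        _ = τ • ((τ⁻¹ * σ * τ) • R) := mul_smul _ _ _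
        _ = τ • R := by rw [hRfix _ hconj]
    rw [smul_sub, h1, hRfix σ hσ]
  have hDzero : ∀ (τ : absoluteGaloisGroup E), τ ∈ localSubgroupOfEmb (κ.layerSubgroup m) ι →
      τ • R = R := by
    intro τ hτ
    obtain ⟨N, hN⟩ := hDtors τ hτ
    have hpN : ((p ^ N : ℕ) : ℤ) ≠ 0 := by exact_mod_cast pow_ne_zero N hp.ne_zero
    let D₁ : AddSubgroup.torsionBy (localPoints W E) ((p ^ N : ℕ) : ℤ) :=
      ⟨τ • R - R, AddSubgroup.torsionBy.nsmul_iff.mpr hN⟩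
    let Dg : W.geomTorsion ((p ^ N : ℕ) : ℤ) :=
      (W.torsionPointsEquiv ((p ^ N : ℕ) : ℤ) (E := E) hpN).symm D₁
    have hDg : pointsMapOfEmb W ι (Dg : W.geomPoints) = τ • R - R :=
      W.pointsMap_torsionPointsEquiv_symm ((p ^ N : ℕ) : ℤ) hpN D₁
    let Dp : W.geomPrimaryTorsion p :=
      ⟨(Dg : W.geomPoints),
        Summit.BirchSwinnertonDyer.Rank1Residual.X11b.Levels.geomTorsion_pow_le_geomPrimaryTorsion W p N
          Dg.2⟩
    have hDp : Dp = 0 := by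
      refine hNT Dp fun σ hσ ↦ ?_
      apply Subtype.ext
      apply pointsMapOfEmb_injective W ι
      change pointsMapOfEmb W ι (((resGalOfEmb ι σ • Dp : W.geomPrimaryTorsion p)) : W.geomPoints) =
        pointsMapOfEmb W ι (Dg : W.geomPoints)
      rw [primaryComponent.coe_smul]
      change pointsMapOfEmb W ι (resGalOfEmb ι σ • (Dg : W.geomPoints)) = _
      rw [pointsMapOfEmb_smul W ι σ, hDg]
      exact hDfix τ hτ σ hσ
    have h0 : (Dg : W.geomPoints) = 0 := congrArg Subtype.val hDp
    rw [← sub_eq_zero, ← hDg, h0, map_zero]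
  -- conclusion: Kobayashi's Kummer condition at the layer `m` with the point `Q + ι t`
  rw [Literature.NumberTheory.EllipticCurves.resOfLe, resH1Hom_oneCocycleClass,
    mem_localKummerOverOfEmb_iff]
  refine ⟨_, Q + pointsMapOfEmb W ι (t : W.geomPoints), k + j, rfl, ?_, fun τ ↦ ?_⟩
  · -- `p^(k+j) (Q + ιt) = p^j (p^k Q) ∈ E^ε(K_{n₀}·K_v) ⊆ E^ε(K_m·K_v)`
    have e : p ^ (k + j) • (Q + pointsMapOfEmb W ι (t : W.geomPoints)) = p ^ j • (p ^ k • Q) := by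
      rw [smul_add, pow_add, mul_comm, mul_smul, mul_comm, mul_smul, ← map_nsmul (pointsMapOfEmb W ι) (p ^ j),
        hj, map_zero, smul_zero, add_zero]
    rw [e]
    exact AddSubgroup.nsmul_mem _ (Summit.BirchSwinnertonDyer.Rank1Residual.Additive.signedLocalPointsOfEmb_mono κ ι W ε hn₀m hQA) _
  · -- the value at `τ ∈ Gal(K̄_v/K_m·K_v)`
    have hτ : (τ : absoluteGaloisGroup E) ∈ localSubgroupOfEmb (κ.layerSubgroup m) ι := τ.2
    have h1 := hP ⟨τ, hm_le_n hτ⟩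
    change pointsMapOfEmb W ι ((φ.1 ⟨resGalOfEmb ι τ, hm_le_n hτ⟩ : W.geomPrimaryTorsion p) :
      W.geomPoints) = (τ : absoluteGaloisGroup E) • P - P at h1
    have h2 : (τ : absoluteGaloisGroup E) • R = R := hDzero τ hτ
    rw [hR, smul_sub, smul_sub] at h2
    have key : pointsMapOfEmb W ι ((φ.1 ⟨resGalOfEmb ι τ, hm_le_n hτ⟩ : W.geomPrimaryTorsion p) :
        W.geomPoints) = (τ : absoluteGaloisGroup E) • (Q + pointsMapOfEmb W ι (t : W.geomPoints)) -
          (Q + pointsMapOfEmb W ι (t : W.geomPoints)) := by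
      rw [h1, smul_add]
      calc (τ : absoluteGaloisGroup E) • P - P
          = ((τ : absoluteGaloisGroup E) • P - (τ : absoluteGaloisGroup E) • Q -
              (τ : absoluteGaloisGroup E) • pointsMapOfEmb W ι (t : W.geomPoints)) - P +
              (τ : absoluteGaloisGroup E) • Q +
              (τ : absoluteGaloisGroup E) • pointsMapOfEmb W ι (t : W.geomPoints) := by abel
        _ = (P - Q - pointsMapOfEmb W ι (t : W.geomPoints)) - P + (τ : absoluteGaloisGroup E) • Q +
              (τ : absoluteGaloisGroup E) • pointsMapOfEmb W ι (t : W.geomPoints) := by rw [h2]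
        _ = (τ : absoluteGaloisGroup E) • Q +
              (τ : absoluteGaloisGroup E) • pointsMapOfEmb W ι (t : W.geomPoints) -
              (Q + pointsMapOfEmb W ι (t : W.geomPoints)) := by abel
    exact key

end Summit.BirchSwinnertonDyer.BirchSwinnertonDyer.Theorems.SignedBaseChangeAcDivXAcTorsionCarrier

end
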